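import Literature.AlgebraicGeometry.Resolution.MacaulayficationKawasakiStepSeven
import Literature.AlgebraicGeometry.Resolution.MacaulayficationKawasakiStepEight
import HarnessLib

/-!
# Kawasaki's interwoven induction, Step 9 (Kawasaki 2000, proof of Thm. 3.1)

Topic: `Literature/AlgebraicGeometry/Resolution`. Brick of the proof of the named facts
`KawasakiMacaulayfication` / `CesnaviciusMacaulayfication`; sequel of
`MacaulayficationKawasakiStepEight.lean`. Step 9 of the printed proof of Kawasaki 2000, Thm. 3.1
(pp. 2528–2530): **if `j > i + 1`, then `(E_ij)` follows from `(B_ij)`, `(C_{i+1,j})`, `(D_ij)` and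
`(E_{i+1,j})`** (the printed list also names `(A_ij)`, which enters only through `(B_ij)`).

* `IsPStandard.kawasakiE31_ones_of_lt` — the all-exponents-`1` case, following the printed chain:
  `(E_{i+1,j})` with the exponent `2` at `i+1` gives `y_ua ∈ (y_{<v},xᵢ,x_Λ)M + q_{i+1}²q_{i+2}⋯qⱼM`;
  `(D_ij)` writes `y_ua = xᵢb + c`; `(C_{i+1,j})` twice, (3.1.9) (= (2.9.2)) and Lemma 2.2 bound `b`;
  `(E_{i+1,j})` once more finishes;
* `IsPStandard.kawasakiE31_of_lt` — `(E_ij)` for `j ≥ i + 2` (reduction to exponents `1` by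
  `IsPStandard.kawasakiE31_of_ones`).

Everything is proved; no named fact is introduced.

## References

* [Kawasaki2000] T. Kawasaki, *On Macaulayfication of Noetherian schemes*, Trans. AMS 352 (2000)
  2517–2552, proof of Thm. 3.1, Step 9 (pp. 2528–2530).
-/

namespace Literature.AlgebraicGeometry.Resolution

open Ideal Submodule Module IsLocalRing
open scoped Pointwise

universe u v

variable {R : Type u} [CommRing R] [IsLocalRing R] [IsNoetherianRing R]
variable {M : Type v} [AddCommGroup M] [Module R M] [Module.Finite R M]

namespace IsPStandard

variable {xs : List R}

/-- **Step 9 of Kawasaki 2000, Thm. 3.1, all exponents `1`** (`0`-based `i + 2 ≤ j < d`): given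
`(C_{i+1,j})`, `(D_ij)` and `(E_{i+1,j})`, for `k ≤ i`, a subsystem of parameters `ys = Y, y_u` of
`M/q_{k+1}M` whose last element kills the parameter colons of `M/q_{k+1}M`, `m < |ys|` and a
sublist `L` of `x_{k+1},…,x_i`:
`[(ys.take m, L)M + qᵢ₊₁⋯qⱼ₊₁M] : ys[m]·y_u = [(ys.take m, L)M + qᵢ₊₁⋯qⱼ₊₁M] : y_u`.
The proof is the printed one, inclusion by inclusion. [cite: Kawasaki2000, Thm. 3.1, Step 9] -/
theorem kawasakiE31_ones_of_lt (hx : IsPStandard M xs) {i j : ℕ} (hij : i + 2 ≤ j)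
    (hj : j < xs.length) (hC1 : Kawasaki.C31 M xs (i + 1) j) (hD : Kawasaki.D31 M xs i j)
    (hE1 : Kawasaki.E31 M xs (i + 1) j) {k : ℕ} (hki : k ≤ i) {ys Y : List R} {yu : R}
    (hY : ys = Y ++ [yu]) (hys : IsSecantSequence M (xs.drop k ++ ys))
    (hym : ∀ y ∈ ys, y ∈ maximalIdeal R)
    (hkill : KillsParameterColons (M ⧸ (tailIdeal xs k • ⊤ : Submodule R M)) yu)
    {m : ℕ} (hm : m < ys.length) {L : List R} (hL : L.Sublist (seg xs k i)) :
    colonBy (ofList (ys.take m ++ L) • ⊤ ⊔ prodPow xs (fun _ => 1) i j • ⊤ : Submodule R M)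
        (ys[m] * yu) =
      colonBy (ofList (ys.take m ++ L) • ⊤ ⊔ prodPow xs (fun _ => 1) i j • ⊤ : Submodule R M) yu := by
  classical
  have hi : i < xs.length := by omega
  -- the subsystems of parameters and their membership in `𝔪`
  obtain ⟨hWv, hWu, -, hWm, hyum⟩ := hx.isSecantSequence_take_append_sublist hki hY hys hym hm hL
  have hyvm : ys[m] ∈ maximalIdeal R := hym _ (List.getElem_mem hm)
  have hxim : xs[i] ∈ maximalIdeal R := hx.mem_maximalIdeal _ (List.getElem_mem hi)
  have hWvm : ∀ z ∈ (ys.take m ++ L) ++ [ys[m]], z ∈ maximalIdeal R := fun z hz => by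
    rcases List.mem_append.mp hz with hz | hz
    · exact hWm z hz
    · rw [List.mem_singleton] at hz; rw [hz]; exact hyvm
  have hWum : ∀ z ∈ (ys.take m ++ L) ++ [yu], z ∈ maximalIdeal R := fun z hz => by
    rcases List.mem_append.mp hz with hz | hz
    · exact hWm z hz
    · rw [List.mem_singleton] at hz; rw [hz]; exact hyum
  have hWuxm : ∀ z ∈ ((ys.take m ++ L) ++ [yu]) ++ [xs[i]], z ∈ maximalIdeal R := fun z hz => by
    rcases List.mem_append.mp hz with hz | hz
    · exact hWum z hz
    · rw [List.mem_singleton] at hz; rw [hz]; exact hxim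
  -- `y₁,…,y_{v-1}, y_u, x_Λ, xᵢ` is a subsystem of parameters of `M/q_{i+1}M` (0-based: `drop (i+1)`)
  have hCsec : IsSecantSequence M (xs.drop (i + 1) ++ (((ys.take m ++ L) ++ [yu]) ++ [xs[i]])) := by
    refine hWu.of_perm ?_ (hx.mem_maximalIdeal_drop_append i hWum)
    rw [List.drop_eq_getElem_cons hi]
    exact List.perm_iff_count.mpr fun r => by
      simp only [List.count_append, List.count_cons, List.count_nil]; omega
  -- `y₁,…,y_{v-1}, x_Λ, y_v` is a subsystem of parameters of `M/q_{i+1}M`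
  have hC2sec : IsSecantSequence M (xs.drop (i + 1) ++ ((ys.take m ++ L) ++ [ys[m]])) :=
    hWv.sublist ((List.drop_sublist_drop_left xs (Nat.le_succ i)).append (List.Sublist.refl _))
      (hx.mem_maximalIdeal_drop_append i hWvm)
  have hL1 : L.Sublist (seg xs k (i + 1)) := by
    rw [seg_succ hki hi]; exact hL.trans (List.sublist_append_left _ _)
  have hL2 : (L ++ [xs[i]]).Sublist (seg xs k (i + 1)) := by
    rw [seg_succ hki hi]; exact hL.append (List.Sublist.refl _)
  -- the ideals: `Q = qᵢQ₊`, `Q₊ = q_{i+1}Q₊'`, the exponents `n₂ = (2,1,…,1)` on `[i+1, j]`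
  have hxq : span {xs[i]} ≤ tailIdeal xs i :=
    (Ideal.span_singleton_le_iff_mem _).mpr (getElem_mem_tailIdeal le_rfl hi)
  have hQ : prodPow xs (fun _ => 1) i j = tailIdeal xs i * prodPow xs (fun _ => 1) (i + 1) j := by
    rw [prodPow_eq_mul _ (by omega : i ≤ j), pow_one]
  obtain ⟨n₂, hn₂⟩ : ∃ n₂ : ℕ → ℕ, n₂ = Function.update (fun _ => 1) (i + 1) 2 := ⟨_, rfl⟩
  have hn₂i : n₂ (i + 1) = 2 := by rw [hn₂, Function.update_self]
  have hn₂t : ∀ t, t ≠ i + 1 → n₂ t = 1 := fun t ht => by rw [hn₂, Function.update_of_ne ht]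
  have hn₂pos : Kawasaki.PosOn n₂ (i + 1) j := fun t _ => by
    rcases eq_or_ne t (i + 1) with rfl | ht
    · rw [hn₂i]; exact Nat.two_pos
    · rw [hn₂t t ht]; exact Nat.one_pos
  have hupd : prodPow xs (Function.update n₂ (i + 1) (n₂ (i + 1) - 1)) (i + 1) j =
      prodPow xs (fun _ => 1) (i + 1) j := by
    refine prodPow_congr fun t _ => ?_
    rcases eq_or_ne t (i + 1) with rfl | ht
    · rw [Function.update_self, hn₂i]
    · rw [Function.update_of_ne ht, hn₂t t ht]
  have hQ2 : prodPow xs n₂ (i + 1) j = tailIdeal xs (i + 1) * prodPow xs (fun _ => 1) (i + 1) j := by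
    rw [prodPow_eq_mul_update (n := n₂) (k := i + 1) (Finset.mem_Icc.mpr ⟨le_rfl, by omega⟩)
      (by rw [hn₂i]; exact Nat.two_pos), hupd]
  have hQ2le : prodPow xs n₂ (i + 1) j ≤ prodPow xs (fun _ => 1) i j := by
    rw [hQ2, hQ]
    exact Ideal.mul_mono_left (tailIdeal_antitone xs (Nat.le_succ i))
  have hQle : prodPow xs (fun _ => 1) i j ≤ span {xs[i]} ⊔ prodPow xs n₂ (i + 1) j := by
    rw [hQ, tailIdeal_eq_span_sup hi, Ideal.sup_mul, ← hQ2]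
    exact sup_le_sup_right Ideal.mul_le_right _
  -- (2.9.2) for `y₁,…,y_{v-1}, x_Λ, y_v, xᵢ` — the middle of (3.1.9)
  have e29 := hx.colonBy_mul_getElem_eq hi hWv hWvm
  rw [mul_comm] at e29
  -- (3.1.9): `(y_{<v},x_Λ)M : y_v ⊆ (y_{<v},x_Λ)M : xᵢ ⊆ (y_{<v},y_u,x_Λ)M : xᵢ`
  have h319 : colonBy (ofList (ys.take m ++ L) • ⊤ : Submodule R M) ys[m] ≤
      colonBy (ofList (ys.take m ++ L) • ⊤ : Submodule R M) xs[i] := fun n hn => by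
    rw [← e29]; exact colonBy_le_colonBy_mul _ _ _ hn
  have h319' : colonBy (ofList (ys.take m ++ L) • ⊤ : Submodule R M) ys[m] ≤
      colonBy (ofList ((ys.take m ++ L) ++ [yu]) • ⊤ : Submodule R M) xs[i] :=
    h319.trans (colonBy_mono (Submodule.smul_mono_left
      (ofList_mono_of_subset (List.subset_append_left _ _))) _)
  refine le_antisymm ?_ (colonBy_le_colonBy_mul _ _ _)
  intro a ha
  rw [mem_colonBy] at ha ⊢
  -- (1) `(E_{i+1,j})` with `n₂`: `y_ua ∈ (y_{<v},x_Λ,xᵢ)M + q_{i+1}²q_{i+2}⋯qⱼM`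
  have hE1a := hE1 n₂ hn₂pos k (by omega) ys Y yu hY hys hym hkill m hm (L ++ [xs[i]]) hL2
  have hW' : (ofList (ys.take m ++ (L ++ [xs[i]])) • ⊤ : Submodule R M) =
      ofList (ys.take m ++ L) • ⊤ ⊔ xs[i] • ⊤ := by
    rw [← List.append_assoc, ofList_append_cons_smul_top, List.append_nil]
  have hle1 : (ofList (ys.take m ++ L) • ⊤ ⊔ prodPow xs (fun _ => 1) i j • ⊤ : Submodule R M) ≤
      (ofList (ys.take m ++ L) • ⊤ ⊔ xs[i] • ⊤) ⊔ prodPow xs n₂ (i + 1) j • ⊤ := by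
    have hsm : (prodPow xs (fun _ => 1) i j • ⊤ : Submodule R M) ≤
        xs[i] • ⊤ ⊔ prodPow xs n₂ (i + 1) j • ⊤ := by
      refine (Submodule.smul_mono_left hQle).trans ?_
      rw [Submodule.sup_smul, Submodule.ideal_span_singleton_smul]
    calc _ ≤ (ofList (ys.take m ++ L) • ⊤ : Submodule R M) ⊔
          (xs[i] • ⊤ ⊔ prodPow xs n₂ (i + 1) j • ⊤) := sup_le_sup_left hsm _
      _ = _ := (sup_assoc _ _ _).symm
  have ha1 : yu • a ∈ (ofList (ys.take m ++ L) • ⊤ ⊔ xs[i] • ⊤ : Submodule R M) ⊔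
      prodPow xs n₂ (i + 1) j • ⊤ := by
    rw [← hW', ← mem_colonBy, ← hE1a, mem_colonBy, hW']
    exact hle1 ha
  -- (2) `y_ua = c + xᵢb₀` with `c ∈ (y_{<v},x_Λ)M + q_{i+1}²q_{i+2}⋯qⱼM`
  have ha1' : yu • a ∈ (ofList (ys.take m ++ L) • ⊤ ⊔ prodPow xs n₂ (i + 1) j • ⊤ : Submodule R M) ⊔
      span {xs[i]} • ⊤ := by
    rw [Submodule.ideal_span_singleton_smul, sup_right_comm]; exact ha1
  obtain ⟨c, hc, t₀, ht₀, ect⟩ := Submodule.mem_sup.mp ha1'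
  obtain ⟨b₀, -, rfl⟩ := mem_span_singleton_smul_iff.mp ht₀
  -- (3) `xᵢb₀ ∈ [(y_{<v},x_Λ)M + QM] : y_v ∩ xᵢM`, so by `(D_ij)`: `xᵢb₀ = xᵢb + w`
  have hU : xs[i] • b₀ ∈ colonBy (ofList (ys.take m ++ L) • ⊤ ⊔ prodPow xs (fun _ => 1) i j • ⊤ :
      Submodule R M) ys[m] := by
    rw [mem_colonBy]
    have e : ys[m] • xs[i] • b₀ = (ys[m] * yu) • a - ys[m] • c := by
      rw [mul_smul, ← ect, smul_add, add_sub_cancel_left]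
    rw [e]
    exact Submodule.sub_mem _ ha (Submodule.smul_mem _ _
      (mem_sup_of_le_right (Submodule.smul_mono_left hQ2le) hc))
  obtain ⟨t₁, ht₁, w, hw, e1⟩ := Submodule.mem_sup.mp (hD hi (ys.take m ++ L) ys[m] hWv hWvm
    (Submodule.mem_inf.mpr ⟨hU, mem_span_singleton_smul_iff.mpr ⟨b₀, Submodule.mem_top, rfl⟩⟩))
  obtain ⟨b, hb, rfl⟩ := mem_span_singleton_smul_iff.mp ht₁
  -- `hb : b ∈ [(y_{<v},x_Λ)M + q_{i+1}⋯qⱼM] : y_v`, `e1 : xᵢb + w = xᵢb₀`, `w ∈ (y_{<v},x_Λ)M`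
  have eyu : yu • a = (c + w) + xs[i] • b := by rw [← ect, ← e1]; abel
  have hcw : c + w ∈ (ofList (ys.take m ++ L) • ⊤ ⊔ prodPow xs n₂ (i + 1) j • ⊤ : Submodule R M) :=
    Submodule.add_mem _ hc (Submodule.mem_sup_left hw)
  -- (4) `(C_{i+1,j})` with `n₂` for `y₁,…,y_{v-1},y_u,x_Λ ; xᵢ`:
  --     `b ∈ (y_{<v},y_u,x_Λ)M : xᵢ + q_{i+1}⋯qⱼM`
  have hbC : b ∈ colonBy (ofList ((ys.take m ++ L) ++ [yu]) • ⊤ ⊔ prodPow xs n₂ (i + 1) j • ⊤ :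
      Submodule R M) xs[i] := by
    rw [mem_colonBy]
    have e : xs[i] • b = yu • a - (c + w) := by rw [eyu, add_sub_cancel_left]
    rw [e, ofList_append_smul]
    refine Submodule.sub_mem _ (Submodule.mem_sup_left (Submodule.mem_sup_right
      (smul_mem_ofList_smul_top (List.mem_singleton_self yu) a))) ?_
    exact mem_sup_of_le_left le_sup_left hcw
  have hC1a := hC1 n₂ hn₂pos ((ys.take m ++ L) ++ [yu]) xs[i] hCsec hWuxm hbC
  rw [hupd] at hC1a
  obtain ⟨x', hx', t, htQ, e2⟩ := Submodule.mem_sup.mp hC1a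
  -- `x' ∈ (y_{<v},y_u,x_Λ)M : xᵢ`, `t ∈ q_{i+1}⋯qⱼM`, `x' + t = b`
  -- (5) `x' ∈ [(y_{<v},x_Λ)M + q_{i+1}⋯qⱼM] : y_v` (modular law)
  have hx'U : x' ∈ colonBy (ofList (ys.take m ++ L) • ⊤ ⊔ prodPow xs (fun _ => 1) (i + 1) j • ⊤ :
      Submodule R M) ys[m] := by
    have e : x' = b - t := by rw [← e2, add_sub_cancel_right]
    rw [e]
    exact Submodule.sub_mem _ hb (le_colonBy _ _ (Submodule.mem_sup_right htQ))
  -- (6) `(C_{i+1,j})`, all exponents `1`, for `y₁,…,y_{v-1},x_Λ ; y_v`, and `j ≥ i+2`: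
  --     `x' ∈ (y_{<v},x_Λ)M : y_v + q_{i+2}M`
  have hC1b := hC1 (fun _ => 1) (Kawasaki.posOn_one _ _) (ys.take m ++ L) ys[m] hC2sec hWvm hx'U
  have hP0 : prodPow xs (Function.update (fun _ : ℕ => 1) (i + 1) ((fun _ : ℕ => 1) (i + 1) - 1))
      (i + 1) j ≤ tailIdeal xs (i + 2) :=
    prodPow_le_tailIdeal (k := i + 2) (Finset.mem_Icc.mpr ⟨Nat.le_succ _, hij⟩)
      (by rw [Function.update_of_ne (Nat.succ_ne_self (i + 1))]; exact Nat.one_pos)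
  have hx'2 : x' ∈ colonBy (ofList (ys.take m ++ L) • ⊤ : Submodule R M) ys[m] ⊔
      tailIdeal xs (i + 2) • ⊤ :=
    mem_sup_of_le_right (Submodule.smul_mono_left hP0) hC1b
  obtain ⟨z, hz, t', ht', e3⟩ := Submodule.mem_sup.mp hx'2
  -- (7) by (3.1.9), `t' = x' - z ∈ (y_{<v},y_u,x_Λ)M : xᵢ ∩ q_{i+2}M ⊆ (y_{<v},y_u,x_Λ)M` (Lemma 2.2)
  have ht'X : xs[i] • t' ∈ (ofList ((ys.take m ++ L) ++ [yu]) • ⊤ : Submodule R M) := by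
    have e : t' = x' - z := by rw [← e3, add_sub_cancel_left]
    rw [e, smul_sub]
    exact Submodule.sub_mem _ (mem_colonBy.mp hx') (mem_colonBy.mp (h319' hz))
  have ht'W : t' ∈ (ofList ((ys.take m ++ L) ++ [yu]) • ⊤ : Submodule R M) := by
    have key := hx.mem_sup_seg_of_smul_mem (ys := (ys.take m ++ L) ++ [yu]) hWu hWum le_rfl hi
      (m := t') (mem_sup_of_le_right (Submodule.smul_mono_left
        (tailIdeal_antitone xs (by omega : i ≤ i + 2))) (Submodule.mem_sup_right ht')) ?_
    · rwa [seg_self, List.append_nil] at key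
    · rw [seg_self, List.append_nil]; exact ht'X
  -- hence `x' = z + t' ∈ (y_{<v},x_Λ)M : y_v + y_uM`
  have hx'3 : x' ∈ colonBy (ofList (ys.take m ++ L) • ⊤ : Submodule R M) ys[m] ⊔ span {yu} • ⊤ := by
    rw [← e3]
    refine Submodule.add_mem _ (Submodule.mem_sup_left hz) ?_
    rw [ofList_append_smul, ofList_singleton] at ht'W
    exact mem_sup_of_le_left (le_colonBy _ _) ht'W
  obtain ⟨z₂, hz₂, t₂, ht₂, e4⟩ := Submodule.mem_sup.mp hx'3
  obtain ⟨e, -, rfl⟩ := mem_span_singleton_smul_iff.mp ht₂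
  -- (8) `y_ue = x' - z₂ ∈ [(y_{<v},x_Λ)M + q_{i+1}⋯qⱼM] : y_v`, so by `(E_{i+1,j})` (exponents `1`):
  --     `y_ue ∈ (y_{<v},x_Λ)M + q_{i+1}⋯qⱼM`
  have heU : e ∈ colonBy (ofList (ys.take m ++ L) • ⊤ ⊔ prodPow xs (fun _ => 1) (i + 1) j • ⊤ :
      Submodule R M) (ys[m] * yu) := by
    rw [mem_colonBy, mul_smul]
    have e5 : yu • e = x' - z₂ := by rw [← e4, add_sub_cancel_left]
    rw [e5, smul_sub]
    exact Submodule.sub_mem _ (mem_colonBy.mp hx'U) (Submodule.mem_sup_left (mem_colonBy.mp hz₂))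
  rw [hE1 (fun _ => 1) (Kawasaki.posOn_one _ _) k (by omega) ys Y yu hY hys hym hkill m hm L hL1,
    mem_colonBy] at heU
  -- (9) assemble: `y_ua = (c + w) + xᵢ(z₂ + y_ue + t) ∈ (y_{<v},x_Λ)M + QM` ("(3.1.9) again")
  have hle2 : span {xs[i]} • (ofList (ys.take m ++ L) • ⊤ ⊔ prodPow xs (fun _ => 1) (i + 1) j • ⊤ :
      Submodule R M) ≤ ofList (ys.take m ++ L) • ⊤ ⊔ prodPow xs (fun _ => 1) i j • ⊤ := by
    refine (Submodule.smul_sup _ _ _).le.trans (sup_le_sup Submodule.smul_le_right ?_)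
    rw [← Submodule.mul_smul, hQ]
    exact Submodule.smul_mono_left (Ideal.mul_mono_left hxq)
  rw [eyu]
  refine Submodule.add_mem _ (mem_sup_of_le_right (Submodule.smul_mono_left hQ2le) hcw) ?_
  rw [← e2, ← e4, smul_add, smul_add]
  refine Submodule.add_mem _ (Submodule.add_mem _ ?_ ?_) ?_
  · -- `xᵢz₂ ∈ (y_{<v},x_Λ)M` by (3.1.9)
    exact Submodule.mem_sup_left (mem_colonBy.mp (h319 hz₂))
  · exact hle2 (Submodule.smul_mem_smul (Ideal.mem_span_singleton_self _) heU)
  · exact hle2 (Submodule.smul_mem_smul (Ideal.mem_span_singleton_self _)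
      (Submodule.mem_sup_right htQ))

/-- **Step 9 of Kawasaki 2000, Thm. 3.1: if `j > i + 1`, then `(E_ij)` follows from `(B_ij)`,
`(C_{i+1,j})`, `(D_ij)` and `(E_{i+1,j})`.** [cite: Kawasaki2000, Thm. 3.1, Step 9] -/
theorem kawasakiE31_of_lt (hx : IsPStandard M xs) {i j : ℕ} (hij : i + 2 ≤ j) (hj : j < xs.length)
    (hB : Kawasaki.B31 M xs i j) (hC1 : Kawasaki.C31 M xs (i + 1) j) (hD : Kawasaki.D31 M xs i j)
    (hE1 : Kawasaki.E31 M xs (i + 1) j) : Kawasaki.E31 M xs i j :=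
  hx.kawasakiE31_of_ones hj hB fun _ hki _ _ _ hY hys hym hkill _ hm _ hL =>
    hx.kawasakiE31_ones_of_lt hij hj hC1 hD hE1 hki hY hys hym hkill hm hL

end IsPStandard

end Literature.AlgebraicGeometry.Resolution
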